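import Literature.Analysis.SpecialFunctions.LiebWuKernels
import Literature.MeasureTheory.Lebesgue.IntervalBoundDomination
import Literature.MathematicalPhysics.QuantumLattice.LiebWuRootDensityLimit
import HarnessLib

/-!
# Counting the Lieb–Wu roots: the finite-`N_a` densities and the domination of the
# thermodynamic limit (Goldbaum 2005, §5, (5.1)–(5.13))

Family `hubbard`, statement hubbard.S10 (`lieb_wu`), node F3a (`goldbaum_rootDensity_tendsto`, file
`LiebWuThermodynamicLimit`): the empirical distribution of the Bethe momenta of the half-filled
Hubbard ring converges to Lieb–Wu's `ρ₀(k) dk`. `LiebWuRootDensityLimit` reduced F3a to the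
IDENTIFICATION of the subsequential weak limits `(μ, ν)` of the empirical measures of the `k`'s and
the `Λ`'s (movement 2 of Goldbaum's proof). This file carries out the first half of that
identification — everything in Goldbaum's §5 up to (5.13) — rigorously and WITHOUT assuming that the
limits have densities:

* **Counting functions.** With `θ = liebWuTheta U`, the Lieb–Wu equations with the ground-state
  quantum numbers say `z_N(k_j) = I_j/N_a`, `w_N(Λ_α) = J_α/N_a` for
  `z_N(x) = (1/2π)[x - N_a⁻¹ Σ_β θ(2 sin x - 2Λ_β)]` (`liebWuCountingK`) and
  `w_N(y) = (1/2πN_a)[Σ_j θ(2 sin k_j - 2y) + Σ_β θ(y - Λ_β)]` (`liebWuCountingΛ`), whose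
  derivatives are the finite-`N_a` densities (`hasDerivAt_liebWuCountingK/Λ`)
  `ρ_N(x) = 1/2π + cos x · N_a⁻¹ Σ_β K_{U/4}(sin x - Λ_β)` (`liebWuDensityK`) and
  `σ_N(y) = N_a⁻¹[Σ_j K_{U/4}(y - sin k_j) - Σ_β K_{U/2}(y - Λ_β)]` (`liebWuDensityΛ`), `K_c` the
  Cauchy density (`LiebWuKernels.cauchyDensity`; `K_{U/4}`, `K_{U/2}` are Lieb–Wu's `K`, `K²`).
* **Counting inequalities** (the mechanism of Goldbaum's (5.1)–(5.4) and of Lieb–Wu's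
  "`f(k_{j+1}) - f(k_j) = 1/N_a`", Physica A 321 (2003) 1, §4): since the roots are increasing and
  occupy consecutive levels, `#{j : k_j ∈ (a, b]} ≤ N_a ∫_a^b (ρ_N)⁺ + 1` and
  `#{α : Λ_α ∈ (a, b]} ≤ N_a ∫_a^b (σ_N)⁺ + 1` (`card_filter_root_mem_Ioc_le`,
  `card_filter_rapidity_mem_Ioc_le`, from the abstract `card_filter_mem_Ioc_le_of_counting`), i.e.
  `μ_N((a,b]) ≤ ∫_a^b (ρ_N)⁺ + 1/N_a`, `ν_M((a,b]) ≤ ∫_a^b (2σ_N)⁺ + 1/M` for the empirical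
  probability measures (`rootMeasure_Ioc_le`, `rapidityMeasure_Ioc_le`).
* **Limit densities and domination** ((5.5)–(5.13)): `ρ_N`, `2σ_N` are the values at the empirical
  measures of `ρ̃_ν(x) = 1/2π + cos x · ½∫K_{U/4}(sin x - t)dν(t)` (`liebWuLimitDensityK`) and
  `σ̃_{μ,ν}(y) = 2∫K_{U/4}(y - sin s)dμ(s) - ∫K_{U/2}(y - t)dν(t)` (`liebWuLimitDensityΛ`); these are
  continuous, uniformly bounded, and converge pointwise under weak convergence, so along any jointly
  convergent subsequence the limits satisfy (by `IntervalBoundDomination`)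
  **`μ ≤ (ρ̃_ν)⁺ dk`** (`rootLimit_le_withDensity`), **`ν ≤ (σ̃_{μ,ν})⁺ dΛ`**
  (`rapidityLimit_le_withDensity`), and `μ([-π, π]ᶜ) = 0` (`rootLimit_compl_Icc_eq_zero`).

Goldbaum instead passes to a.e.-convergent subsequences of the step densities and obtains the
EQUALITIES (5.10)–(5.11) on the accumulation sets `Q`, `B`; the inequalities above are what survives
for arbitrary weak limits and are the input of the contraction argument (Lieb–Wu 2003, §5–6:
positivity of the kernels of `Û`, `R̂`, `‖Û‖ = 1/2`, Lemma 5) that identifies `μ = ρ₀ dk`.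

## References

* P. S. Goldbaum, CMP 258 (2005) 317–337 = arXiv:cond-mat/0403736 (held; key `Goldbaum2005`), §5,
  (5.1)–(5.13).
* E. H. Lieb, F. Y. Wu, Physica A 321 (2003) 1–27 = arXiv:cond-mat/0207529 (held; key
  `LiebWuPhysicaA2003`), §3 (Lieb–Wu equations, `θ`), §4 (`ρ = ∂_k f`, the integral equations).
* Mathlib: `HasDerivAt.arctan`, `intervalIntegral.integral_eq_sub_of_hasDerivAt`,
  `ProbabilityMeasure.tendsto_iff_forall_integral_tendsto`,
  `ProbabilityMeasure.limsup_measure_closed_le_of_tendsto`, `continuous_of_dominated`.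
-/

noncomputable section

open Filter Finset MeasureTheory Set Real
open Literature.Analysis.SpecialFunctions Literature.MeasureTheory.Lebesgue
open scoped Topology BigOperators ENNReal NNReal BoundedContinuousFunction

namespace Literature.MathematicalPhysics.QuantumLattice

/-! ### Lieb–Wu's counting functions `z_N`, `w_N` and their derivatives -/

/-- Lieb–Wu's **counting function for the momenta** on the ring of `N_a = 4m + 2` sites:
`z_N(x) = (1/2π) [x - (1/N_a) Σ_β θ(2 sin x - 2Λ_β)]`, so that the first Lieb–Wu equation reads
`z_N(k_j) = I_j / N_a`. Lieb–Wu, Physica A 321 (2003) 1, §4 (the function whose derivative is the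
finite-`N_a` density `ρ`); Goldbaum, CMP 258 (2005) 317, §5, (5.5)–(5.7).
[cite: LiebWuPhysicaA2003, §4] -/
def liebWuCountingK (U : ℝ) (m : ℕ) (Λ : Fin (2 * m + 1) → ℝ) (x : ℝ) : ℝ :=
  (x - (∑ β, liebWuTheta U (2 * Real.sin x - 2 * Λ β)) / (4 * m + 2 : ℝ)) / (2 * π)

/-- The derivative of `z_N`: `z_N'(x) = 1/(2π) + cos x · (1/N_a) Σ_β K_{U/4}(sin x - Λ_β)`, the
finite-`N_a` form of Lieb–Wu's first integral equation `ρ(k) = 1/2π + cos k ∫ K(sin k - Λ) σ(Λ) dΛ`.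
[cite: LiebWuPhysicaA2003, §4] -/
def liebWuDensityK (U : ℝ) (m : ℕ) (Λ : Fin (2 * m + 1) → ℝ) (x : ℝ) : ℝ :=
  1 / (2 * π) + Real.cos x * ((∑ β, cauchyDensity (U / 4) (Real.sin x - Λ β)) / (4 * m + 2 : ℝ))

/-- Lieb–Wu's **counting function for the `Λ`'s**:
`w_N(y) = (1/2πN_a) [Σ_j θ(2 sin k_j - 2y) + Σ_β θ(y - Λ_β)]`, so that the second Lieb–Wu equation
reads `w_N(Λ_α) = J_α / N_a`. [cite: LiebWuPhysicaA2003, §4] -/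
def liebWuCountingΛ (U : ℝ) (m : ℕ) (k : Fin (4 * m + 2) → ℝ) (Λ : Fin (2 * m + 1) → ℝ) (y : ℝ) : ℝ :=
  ((∑ j, liebWuTheta U (2 * Real.sin (k j) - 2 * y)) + ∑ β, liebWuTheta U (y - Λ β)) /
    (4 * m + 2 : ℝ) / (2 * π)

/-- The derivative of `w_N`: `w_N'(y) = (1/N_a) [Σ_j K_{U/4}(y - sin k_j) - Σ_β K_{U/2}(y - Λ_β)]`,
the finite-`N_a` form of Lieb–Wu's second integral equation
`σ(Λ) = ∫ K(sin k - Λ) ρ(k) dk - ∫ K²(Λ - Λ') σ(Λ') dΛ'`. [cite: LiebWuPhysicaA2003, §4] -/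
def liebWuDensityΛ (U : ℝ) (m : ℕ) (k : Fin (4 * m + 2) → ℝ) (Λ : Fin (2 * m + 1) → ℝ) (y : ℝ) : ℝ :=
  ((∑ j, cauchyDensity (U / 4) (y - Real.sin (k j))) - ∑ β, cauchyDensity (U / 2) (y - Λ β)) /
    (4 * m + 2 : ℝ)

/-- The first Lieb–Wu equation in counting form: `z_N(k_j) = I_j/N_a`.
[cite: LiebWuPhysicaA2003, §3] -/
theorem liebWuCountingK_root {U : ℝ} {m : ℕ} {k : Fin (4 * m + 2) → ℝ} {Λ : Fin (2 * m + 1) → ℝ}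
    (hk : IsLiebWuGroundRoots U m k Λ) (j : Fin (4 * m + 2)) :
    liebWuCountingK U m Λ (k j) = liebWuGroundNumbers (4 * m + 2) j / (4 * m + 2 : ℝ) := by
  have h := hk.1.1 j
  push_cast at h
  have hN : (0 : ℝ) < 4 * m + 2 := by positivity
  have hπ : 0 < 2 * π := by positivity
  unfold liebWuCountingK
  rw [div_eq_div_iff hπ.ne' hN.ne', sub_mul, div_mul_cancel₀ _ hN.ne']
  linarith [h]

/-- The second Lieb–Wu equation in counting form: `w_N(Λ_α) = J_α/N_a`.
[cite: LiebWuPhysicaA2003, §3] -/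
theorem liebWuCountingΛ_root {U : ℝ} {m : ℕ} {k : Fin (4 * m + 2) → ℝ} {Λ : Fin (2 * m + 1) → ℝ}
    (hk : IsLiebWuGroundRoots U m k Λ) (α : Fin (2 * m + 1)) :
    liebWuCountingΛ U m k Λ (Λ α) = liebWuGroundNumbers (2 * m + 1) α / (4 * m + 2 : ℝ) := by
  have h := hk.1.2 α
  have hN : (0 : ℝ) < 4 * m + 2 := by positivity
  have hπ : 0 < 2 * π := by positivity
  rw [liebWuCountingΛ, div_div, div_eq_div_iff (by positivity) hN.ne']
  rw [h]
  ring

/-- `d/dx θ_U(2 sin x - 2Λ) = -2π cos x · K_{U/4}(sin x - Λ)` (`U > 0`). [cite: LiebWuPhysicaA2003, §4] -/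
theorem hasDerivAt_liebWuTheta_sin {U : ℝ} (hU : 0 < U) (Λ x : ℝ) :
    HasDerivAt (fun x => liebWuTheta U (2 * Real.sin x - 2 * Λ))
      (-(2 * π) * (Real.cos x * cauchyDensity (U / 4) (Real.sin x - Λ))) x := by
  have h1 : HasDerivAt (fun x => 2 * (2 * Real.sin x - 2 * Λ) / U) (2 * (2 * Real.cos x) / U) x := by
    have := ((Real.hasDerivAt_sin x).const_mul 2).sub_const (2 * Λ)
    convert (this.const_mul 2).div_const U using 1
  have h2 := h1.arctan.const_mul (-2 : ℝ)
  have heq : (fun x => -2 * Real.arctan (2 * (2 * Real.sin x - 2 * Λ) / U)) =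
      fun x => liebWuTheta U (2 * Real.sin x - 2 * Λ) := by
    funext x; rw [liebWuTheta]
  rw [heq] at h2
  refine h2.congr_deriv ?_
  unfold cauchyDensity
  have hπ := Real.pi_pos
  field_simp
  ring

/-- `d/dy θ_U(2 s - 2y) = 2π K_{U/4}(y - s)`. [cite: LiebWuPhysicaA2003, §4] -/
theorem hasDerivAt_liebWuTheta_sub_right {U : ℝ} (hU : 0 < U) (s y : ℝ) :
    HasDerivAt (fun y => liebWuTheta U (2 * s - 2 * y)) (2 * π * cauchyDensity (U / 4) (y - s)) y := by
  have h1 : HasDerivAt (fun y => 2 * (2 * s - 2 * y) / U) (2 * (-2) / U) y := by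
    have : HasDerivAt (fun y => 2 * s - 2 * y) (-2) y := by
      simpa using ((hasDerivAt_id y).const_mul 2).const_sub (2 * s)
    convert (this.const_mul 2).div_const U using 1
  have h2 := h1.arctan.const_mul (-2 : ℝ)
  have heq : (fun y => -2 * Real.arctan (2 * (2 * s - 2 * y) / U)) =
      fun y => liebWuTheta U (2 * s - 2 * y) := by
    funext y; rw [liebWuTheta]
  rw [heq] at h2
  refine h2.congr_deriv ?_
  unfold cauchyDensity
  have hπ := Real.pi_pos
  field_simp
  ring

/-- `d/dy θ_U(y - Λ) = -2π K_{U/2}(y - Λ)`. [cite: LiebWuPhysicaA2003, §4] -/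
theorem hasDerivAt_liebWuTheta_sub_left {U : ℝ} (hU : 0 < U) (Λ y : ℝ) :
    HasDerivAt (fun y => liebWuTheta U (y - Λ)) (-(2 * π) * cauchyDensity (U / 2) (y - Λ)) y := by
  have h1 : HasDerivAt (fun y => 2 * (y - Λ) / U) (2 * 1 / U) y := by
    have : HasDerivAt (fun y => y - Λ) 1 y := (hasDerivAt_id y).sub_const Λ
    exact (this.const_mul 2).div_const U
  have h2 := h1.arctan.const_mul (-2 : ℝ)
  have heq : (fun y => -2 * Real.arctan (2 * (y - Λ) / U)) = fun y => liebWuTheta U (y - Λ) := by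
    funext y; rw [liebWuTheta]
  rw [heq] at h2
  refine h2.congr_deriv ?_
  unfold cauchyDensity
  have hπ := Real.pi_pos
  field_simp

/-- **`z_N' = ρ_N`**: the counting function of the momenta has derivative `liebWuDensityK`.
[cite: LiebWuPhysicaA2003, §4] -/
theorem hasDerivAt_liebWuCountingK {U : ℝ} (hU : 0 < U) (m : ℕ) (Λ : Fin (2 * m + 1) → ℝ) (x : ℝ) :
    HasDerivAt (liebWuCountingK U m Λ) (liebWuDensityK U m Λ x) x := by
  have hsum : HasDerivAt (fun x => ∑ β, liebWuTheta U (2 * Real.sin x - 2 * Λ β))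
      (∑ β, -(2 * π) * (Real.cos x * cauchyDensity (U / 4) (Real.sin x - Λ β))) x :=
    HasDerivAt.fun_sum fun β _ => hasDerivAt_liebWuTheta_sin hU (Λ β) x
  have h := (((hasDerivAt_id x).sub (hsum.div_const (4 * m + 2 : ℝ))).div_const (2 * π))
  have h' : HasDerivAt (liebWuCountingK U m Λ)
      ((1 - (∑ β, -(2 * π) * (Real.cos x * cauchyDensity (U / 4) (Real.sin x - Λ β))) /
        (4 * m + 2 : ℝ)) / (2 * π)) x :=
    h.congr_of_eventuallyEq (Eventually.of_forall fun y => rfl)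
  refine h'.congr_deriv ?_
  simp only [liebWuDensityK, ← Finset.mul_sum]
  have hπ := Real.pi_pos
  have hN : (0 : ℝ) < 4 * m + 2 := by positivity
  field_simp
  ring

/-- **`w_N' = σ_N`**: the counting function of the `Λ`'s has derivative `liebWuDensityΛ`.
[cite: LiebWuPhysicaA2003, §4] -/
theorem hasDerivAt_liebWuCountingΛ {U : ℝ} (hU : 0 < U) (m : ℕ) (k : Fin (4 * m + 2) → ℝ)
    (Λ : Fin (2 * m + 1) → ℝ) (y : ℝ) :
    HasDerivAt (liebWuCountingΛ U m k Λ) (liebWuDensityΛ U m k Λ y) y := by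
  have hsum1 : HasDerivAt (fun y => ∑ j, liebWuTheta U (2 * Real.sin (k j) - 2 * y))
      (∑ j, 2 * π * cauchyDensity (U / 4) (y - Real.sin (k j))) y :=
    HasDerivAt.fun_sum fun j _ => hasDerivAt_liebWuTheta_sub_right hU (Real.sin (k j)) y
  have hsum2 : HasDerivAt (fun y => ∑ β, liebWuTheta U (y - Λ β))
      (∑ β, -(2 * π) * cauchyDensity (U / 2) (y - Λ β)) y :=
    HasDerivAt.fun_sum fun β _ => hasDerivAt_liebWuTheta_sub_left hU (Λ β) y
  have h := ((hsum1.add hsum2).div_const (4 * m + 2 : ℝ)).div_const (2 * π)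
  have h' : HasDerivAt (liebWuCountingΛ U m k Λ)
      (((∑ j, 2 * π * cauchyDensity (U / 4) (y - Real.sin (k j))) +
        ∑ β, -(2 * π) * cauchyDensity (U / 2) (y - Λ β)) / (4 * m + 2 : ℝ) / (2 * π)) y :=
    h.congr_of_eventuallyEq (Eventually.of_forall fun t => rfl)
  refine h'.congr_deriv ?_
  simp only [liebWuDensityΛ, ← Finset.mul_sum]
  have hπ := Real.pi_pos
  have hN : (0 : ℝ) < 4 * m + 2 := by positivity
  field_simp
  ring

/-- `ρ_N` is continuous. [folklore] -/
theorem continuous_liebWuDensityK {U : ℝ} (hU : 0 < U) (m : ℕ) (Λ : Fin (2 * m + 1) → ℝ) :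
    Continuous (liebWuDensityK U m Λ) := by
  unfold liebWuDensityK
  have hc := continuous_cauchyDensity (by positivity : 0 < U / 4)
  fun_prop

/-- `σ_N` is continuous. [folklore] -/
theorem continuous_liebWuDensityΛ {U : ℝ} (hU : 0 < U) (m : ℕ) (k : Fin (4 * m + 2) → ℝ)
    (Λ : Fin (2 * m + 1) → ℝ) : Continuous (liebWuDensityΛ U m k Λ) := by
  unfold liebWuDensityΛ
  have hc := continuous_cauchyDensity (by positivity : 0 < U / 4)
  have hc' := continuous_cauchyDensity (by positivity : 0 < U / 2)
  fun_prop

/-- Uniform bound `|ρ_N| ≤ 1/(2π) + 2/(πU)` (`K_{U/4} ≤ 4/(πU)`, `M/N_a = 1/2`). [folklore] -/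
theorem abs_liebWuDensityK_le {U : ℝ} (hU : 0 < U) (m : ℕ) (Λ : Fin (2 * m + 1) → ℝ) (x : ℝ) :
    |liebWuDensityK U m Λ x| ≤ 1 / (2 * π) + 2 / (π * U) := by
  have hc : 0 < U / 4 := by positivity
  have hN : (0 : ℝ) < 4 * m + 2 := by positivity
  have hsum : |∑ β, cauchyDensity (U / 4) (Real.sin x - Λ β)| ≤ (2 * m + 1 : ℝ) * (1 / (π * (U / 4))) := by
    rw [abs_of_nonneg (Finset.sum_nonneg fun β _ => (cauchyDensity_pos hc _).le)]
    calc ∑ β, cauchyDensity (U / 4) (Real.sin x - Λ β) ≤ ∑ _β : Fin (2 * m + 1), 1 / (π * (U / 4)) :=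
          Finset.sum_le_sum fun β _ => cauchyDensity_le hc _
      _ = (2 * m + 1 : ℝ) * (1 / (π * (U / 4))) := by
          rw [Finset.sum_const, Finset.card_univ, Fintype.card_fin, nsmul_eq_mul]; push_cast; ring
  rw [liebWuDensityK]
  have h1 : |Real.cos x * ((∑ β, cauchyDensity (U / 4) (Real.sin x - Λ β)) / (4 * m + 2 : ℝ))| ≤
      2 / (π * U) := by
    rw [abs_mul, abs_div, abs_of_pos hN]
    calc |Real.cos x| * (|∑ β, cauchyDensity (U / 4) (Real.sin x - Λ β)| / (4 * m + 2 : ℝ))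
        ≤ 1 * ((2 * m + 1 : ℝ) * (1 / (π * (U / 4))) / (4 * m + 2 : ℝ)) := by
          gcongr
          exact Real.abs_cos_le_one x
      _ = 2 / (π * U) := by
          have hπ := Real.pi_pos
          field_simp
          ring
  have hπ : 0 < 1 / (2 * π) := by positivity
  calc |1 / (2 * π) + Real.cos x * ((∑ β, cauchyDensity (U / 4) (Real.sin x - Λ β)) / (4 * m + 2 : ℝ))|
      ≤ |1 / (2 * π)| + |Real.cos x * ((∑ β, cauchyDensity (U / 4) (Real.sin x - Λ β)) / (4 * m + 2 : ℝ))| :=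
        abs_add_le _ _
    _ ≤ 1 / (2 * π) + 2 / (π * U) := by rw [abs_of_pos hπ]; gcongr

/-- Uniform bound `|σ_N| ≤ 4/(πU) + 1/(πU)`. [folklore] -/
theorem abs_liebWuDensityΛ_le {U : ℝ} (hU : 0 < U) (m : ℕ) (k : Fin (4 * m + 2) → ℝ)
    (Λ : Fin (2 * m + 1) → ℝ) (y : ℝ) :
    |liebWuDensityΛ U m k Λ y| ≤ 4 / (π * U) + 1 / (π * U) := by
  have hc : 0 < U / 4 := by positivity
  have hc' : 0 < U / 2 := by positivity
  have hN : (0 : ℝ) < 4 * m + 2 := by positivity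
  have hπ := Real.pi_pos
  have h1 : |∑ j, cauchyDensity (U / 4) (y - Real.sin (k j))| ≤ (4 * m + 2 : ℝ) * (1 / (π * (U / 4))) := by
    rw [abs_of_nonneg (Finset.sum_nonneg fun j _ => (cauchyDensity_pos hc _).le)]
    calc ∑ j, cauchyDensity (U / 4) (y - Real.sin (k j)) ≤ ∑ _j : Fin (4 * m + 2), 1 / (π * (U / 4)) :=
          Finset.sum_le_sum fun j _ => cauchyDensity_le hc _
      _ = (4 * m + 2 : ℝ) * (1 / (π * (U / 4))) := by
          rw [Finset.sum_const, Finset.card_univ, Fintype.card_fin, nsmul_eq_mul]; push_cast; ring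
  have h2 : |∑ β, cauchyDensity (U / 2) (y - Λ β)| ≤ (2 * m + 1 : ℝ) * (1 / (π * (U / 2))) := by
    rw [abs_of_nonneg (Finset.sum_nonneg fun β _ => (cauchyDensity_pos hc' _).le)]
    calc ∑ β, cauchyDensity (U / 2) (y - Λ β) ≤ ∑ _β : Fin (2 * m + 1), 1 / (π * (U / 2)) :=
          Finset.sum_le_sum fun β _ => cauchyDensity_le hc' _
      _ = (2 * m + 1 : ℝ) * (1 / (π * (U / 2))) := by
          rw [Finset.sum_const, Finset.card_univ, Fintype.card_fin, nsmul_eq_mul]; push_cast; ring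
  rw [liebWuDensityΛ, abs_div, abs_of_pos hN, div_le_iff₀ hN]
  calc |(∑ j, cauchyDensity (U / 4) (y - Real.sin (k j))) - ∑ β, cauchyDensity (U / 2) (y - Λ β)|
      ≤ |∑ j, cauchyDensity (U / 4) (y - Real.sin (k j))| + |∑ β, cauchyDensity (U / 2) (y - Λ β)| :=
        abs_sub _ _
    _ ≤ (4 * m + 2 : ℝ) * (1 / (π * (U / 4))) + (2 * m + 1 : ℝ) * (1 / (π * (U / 2))) := add_le_add h1 h2
    _ ≤ (4 / (π * U) + 1 / (π * U)) * (4 * m + 2 : ℝ) := by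
        have hm : (0 : ℝ) ≤ m := Nat.cast_nonneg m
        field_simp
        nlinarith

/-! ### The counting inequalities -/

/-- **Abstract root counting.** Let `x₀ < x₁ < ⋯` be finitely many reals and `Z` a function with
continuous derivative `Z'` such that `Z(x_i) = (i + c)/N` (one root per level `1/N`). Then for
`a ≤ b`, `#{i : x_i ∈ (a, b]} ≤ N ∫_a^b (Z')⁺ + 1`: the indices with `x_i ∈ (a, b]` form a block
`i₀ ≤ ⋯ ≤ i₁`, and `(i₁ - i₀)/N = Z(x_{i₁}) - Z(x_{i₀}) = ∫ Z' ≤ ∫_a^b (Z')⁺`. This is the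
mechanism behind Goldbaum's bounds (5.1)–(5.4) and Lieb–Wu's "`ρ(k) = ∂_k f`, `f(k_{j+1}) - f(k_j) =
1/N_a`" (Physica A 321 (2003) 1, §4). [cite: Goldbaum2005, §5, eqs. (5.1)–(5.4)] -/
theorem card_filter_mem_Ioc_le_of_counting {n : ℕ} {x : Fin n → ℝ} (hx : StrictMono x)
    {Z Z' : ℝ → ℝ} (hZ : ∀ t, HasDerivAt Z (Z' t) t) (hZ' : Continuous Z') {N c : ℝ} (hN : 0 < N)
    (hroot : ∀ i, Z (x i) = ((i : ℝ) + c) / N) {a b : ℝ} (hab : a ≤ b) :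
    ((univ.filter fun i => x i ∈ Ioc a b).card : ℝ) ≤ N * (∫ t in a..b, max (Z' t) 0) + 1 := by
  set A := univ.filter fun i => x i ∈ Ioc a b with hA
  have hpos : 0 ≤ ∫ t in a..b, max (Z' t) 0 :=
    intervalIntegral.integral_nonneg hab fun t _ => le_max_right _ _
  rcases A.eq_empty_or_nonempty with hAe | hAne
  · rw [hAe, Finset.card_empty, Nat.cast_zero]
    nlinarith [mul_nonneg hN.le hpos]
  · set i₀ := A.min' hAne
    set i₁ := A.max' hAne
    have hi₀ : i₀ ∈ A := A.min'_mem hAne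
    have hi₁ : i₁ ∈ A := A.max'_mem hAne
    have hle : i₀ ≤ i₁ := A.min'_le _ hi₁
    have hx₀ : x i₀ ∈ Ioc a b := (Finset.mem_filter.1 hi₀).2
    have hx₁ : x i₁ ∈ Ioc a b := (Finset.mem_filter.1 hi₁).2
    have hsub : A ⊆ Finset.Icc i₀ i₁ := fun i hi =>
      Finset.mem_Icc.2 ⟨A.min'_le i hi, A.le_max' i hi⟩
    have hcard : (A.card : ℝ) ≤ (i₁ : ℝ) - i₀ + 1 := by
      have h1 : A.card ≤ (i₁ : ℕ) + 1 - i₀ := (Finset.card_le_card hsub).trans (Fin.card_Icc i₀ i₁).le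
      have h2 : ((i₁ : ℕ) + 1 - (i₀ : ℕ) : ℕ) = ((i₁ : ℝ) - i₀ + 1 : ℝ) := by
        rw [Nat.cast_sub (by have := Fin.le_iff_val_le_val.1 hle; omega)]
        push_cast
        ring
      exact_mod_cast (Nat.cast_le (α := ℝ)).2 h1 |>.trans h2.le
    -- `(i₁ - i₀)/N = Z(x i₁) - Z(x i₀) = ∫ Z' ≤ ∫_a^b (Z')⁺`
    have hxle : x i₀ ≤ x i₁ := hx.monotone hle
    have hFTC : ∫ t in (x i₀)..(x i₁), Z' t = Z (x i₁) - Z (x i₀) :=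
      intervalIntegral.integral_eq_sub_of_hasDerivAt (fun t _ => hZ t) (hZ'.intervalIntegrable _ _)
    have hdiff : ((i₁ : ℝ) - i₀) / N = ∫ t in (x i₀)..(x i₁), Z' t := by
      rw [hFTC, hroot, hroot]
      ring
    have hint : ∫ t in (x i₀)..(x i₁), Z' t ≤ ∫ t in a..b, max (Z' t) 0 := by
      calc ∫ t in (x i₀)..(x i₁), Z' t ≤ ∫ t in (x i₀)..(x i₁), max (Z' t) 0 :=
            intervalIntegral.integral_mono_on hxle (hZ'.intervalIntegrable _ _)
              ((hZ'.max continuous_const).intervalIntegrable _ _) fun t _ => le_max_left _ _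
        _ ≤ ∫ t in a..b, max (Z' t) 0 :=
            intervalIntegral.integral_mono_interval hx₀.1.le hxle hx₁.2
              (Eventually.of_forall fun t => le_max_right _ _)
              ((hZ'.max continuous_const).intervalIntegrable _ _)
    have key : (i₁ : ℝ) - i₀ ≤ N * ∫ t in a..b, max (Z' t) 0 := by
      have := (div_le_iff₀ hN).1 (hdiff.le.trans hint)
      linarith
    linarith

/-- **Counting inequality for the momenta (Goldbaum 2005, §5, (5.1)–(5.2)).** For ground-state
roots on the ring of `N_a = 4m + 2` sites and `a ≤ b`:
`#{j : k_j ∈ (a, b]} ≤ N_a ∫_a^b (ρ_N)⁺ + 1`. [cite: Goldbaum2005, §5, eqs. (5.1)–(5.2)] -/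
theorem card_filter_root_mem_Ioc_le {U : ℝ} (hU : 0 < U) {m : ℕ} {k : Fin (4 * m + 2) → ℝ}
    {Λ : Fin (2 * m + 1) → ℝ} (hk : IsLiebWuGroundRoots U m k Λ) {a b : ℝ} (hab : a ≤ b) :
    ((univ.filter fun j => k j ∈ Ioc a b).card : ℝ) ≤
      (4 * m + 2 : ℝ) * (∫ t in a..b, max (liebWuDensityK U m Λ t) 0) + 1 := by
  refine card_filter_mem_Ioc_le_of_counting hk.2.1 (hasDerivAt_liebWuCountingK hU m Λ)
    (continuous_liebWuDensityK hU m Λ) (by positivity) (c := -(((4 * m + 2 : ℕ) : ℝ) - 1) / 2)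
    (fun j => ?_) hab
  rw [liebWuCountingK_root hk, liebWuGroundNumbers]
  push_cast
  ring

/-- **Counting inequality for the `Λ`'s (Goldbaum 2005, §5, (5.3)–(5.4)).** For ground-state roots
on the ring of `N_a = 4m + 2` sites and `a ≤ b`: `#{α : Λ_α ∈ (a, b]} ≤ N_a ∫_a^b (σ_N)⁺ + 1`.
[cite: Goldbaum2005, §5, eqs. (5.3)–(5.4)] -/
theorem card_filter_rapidity_mem_Ioc_le {U : ℝ} (hU : 0 < U) {m : ℕ} {k : Fin (4 * m + 2) → ℝ}
    {Λ : Fin (2 * m + 1) → ℝ} (hk : IsLiebWuGroundRoots U m k Λ) {a b : ℝ} (hab : a ≤ b) :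
    ((univ.filter fun α => Λ α ∈ Ioc a b).card : ℝ) ≤
      (4 * m + 2 : ℝ) * (∫ t in a..b, max (liebWuDensityΛ U m k Λ t) 0) + 1 := by
  refine card_filter_mem_Ioc_le_of_counting hk.2.2.1 (hasDerivAt_liebWuCountingΛ hU m k Λ)
    (continuous_liebWuDensityΛ hU m k Λ) (by positivity) (c := -(((2 * m + 1 : ℕ) : ℝ) - 1) / 2)
    (fun α => ?_) hab
  rw [liebWuCountingΛ_root hk, liebWuGroundNumbers]
  push_cast
  ring


/-! ### The counting inequalities for the empirical measures -/

/-- **Counting inequality for the empirical measure of the momenta**: for `a < b`,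
`μ_N((a, b]) ≤ ∫_a^b (ρ_N)⁺ + 1/N_a`. [cite: Goldbaum2005, §5, eqs. (5.1)–(5.2)] -/
theorem rootMeasure_Ioc_le {U : ℝ} (hU : 0 < U) {m : ℕ} {k : Fin (4 * m + 2) → ℝ}
    {Λ : Fin (2 * m + 1) → ℝ} (hk : IsLiebWuGroundRoots U m k Λ) {a b : ℝ} (hab : a < b) :
    (empiricalProbabilityMeasure k : Measure ℝ) (Ioc a b) ≤
      ENNReal.ofReal ((∫ t in a..b, max (liebWuDensityK U m Λ t) 0) + 1 / (4 * m + 2 : ℝ)) := by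
  refine (empiricalProbabilityMeasure_apply_le_ofReal k _).trans (ENNReal.ofReal_le_ofReal ?_)
  have hN : (0 : ℝ) < 4 * m + 2 := by positivity
  have hcnt := card_filter_root_mem_Ioc_le hU hk hab.le
  have hcast : (((4 * m + 1 : ℕ) : ℝ) + 1) = (4 * m + 2 : ℝ) := by push_cast; ring
  rw [hcast, div_le_iff₀ hN]
  have : ((∫ t in a..b, max (liebWuDensityK U m Λ t) 0) + 1 / (4 * m + 2 : ℝ)) * (4 * m + 2 : ℝ) =
      (4 * m + 2 : ℝ) * (∫ t in a..b, max (liebWuDensityK U m Λ t) 0) + 1 := by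
    field_simp
  rw [this]
  exact hcnt

/-- **Counting inequality for the empirical measure of the `Λ`'s**: for `a < b`,
`ν_M((a, b]) ≤ ∫_a^b (2σ_N)⁺ + 1/M` (`N_a/M = 2`). [cite: Goldbaum2005, §5, eqs. (5.3)–(5.4)] -/
theorem rapidityMeasure_Ioc_le {U : ℝ} (hU : 0 < U) {m : ℕ} {k : Fin (4 * m + 2) → ℝ}
    {Λ : Fin (2 * m + 1) → ℝ} (hk : IsLiebWuGroundRoots U m k Λ) {a b : ℝ} (hab : a < b) :
    (empiricalProbabilityMeasure Λ : Measure ℝ) (Ioc a b) ≤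
      ENNReal.ofReal ((∫ t in a..b, max (2 * liebWuDensityΛ U m k Λ t) 0) + 1 / (2 * m + 1 : ℝ)) := by
  refine (empiricalProbabilityMeasure_apply_le_ofReal Λ _).trans (ENNReal.ofReal_le_ofReal ?_)
  have hM : (0 : ℝ) < 2 * m + 1 := by positivity
  have hcnt := card_filter_rapidity_mem_Ioc_le hU hk hab.le
  have hcast : (((2 * m : ℕ) : ℝ) + 1) = (2 * m + 1 : ℝ) := by push_cast; ring
  have hmax : ∀ t, max (2 * liebWuDensityΛ U m k Λ t) 0 = 2 * max (liebWuDensityΛ U m k Λ t) 0 := by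
    intro t
    rcases le_or_gt 0 (liebWuDensityΛ U m k Λ t) with h | h
    · rw [max_eq_left h, max_eq_left (by linarith)]
    · rw [max_eq_right h.le, max_eq_right (by linarith), mul_zero]
  simp_rw [hmax]
  rw [intervalIntegral.integral_const_mul, hcast, div_le_iff₀ hM]
  have : (2 * (∫ t in a..b, max (liebWuDensityΛ U m k Λ t) 0) + 1 / (2 * m + 1 : ℝ)) * (2 * m + 1 : ℝ) =
      (4 * m + 2 : ℝ) * (∫ t in a..b, max (liebWuDensityΛ U m k Λ t) 0) + 1 := by
    field_simp
    ring
  rw [this]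
  exact hcnt

/-! ### The limit densities `ρ̃`, `σ̃` of a pair of limit measures -/

/-- The **limit form of `ρ_N`** for a measure `ν` (the would-be distribution of the `Λ`'s):
`ρ̃(x) = 1/(2π) + cos x · ½ ∫ K_{U/4}(sin x - t) dν(t)` (Goldbaum's (5.10) with the indicator of
`B` replaced by the measure `ν`; the factor `½ = M/N_a`). [cite: Goldbaum2005, §5, eq. (5.10)] -/
def liebWuLimitDensityK (U : ℝ) (ν : Measure ℝ) (x : ℝ) : ℝ :=
  1 / (2 * π) + Real.cos x * ((1 / 2) * ∫ t, cauchyDensity (U / 4) (Real.sin x - t) ∂ν)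

/-- The **limit form of `2σ_N`** for measures `μ` (momenta) and `ν` (`Λ`'s):
`σ̃(y) = 2 ∫ K_{U/4}(y - sin s) dμ(s) - ∫ K_{U/2}(y - t) dν(t)` (Goldbaum's (5.11), normalised
to the probability measure of the `Λ`'s). [cite: Goldbaum2005, §5, eq. (5.11)] -/
def liebWuLimitDensityΛ (U : ℝ) (μ ν : Measure ℝ) (y : ℝ) : ℝ :=
  2 * ∫ s, cauchyDensity (U / 4) (y - Real.sin s) ∂μ - ∫ t, cauchyDensity (U / 2) (y - t) ∂ν

/-- `ρ_N` is `ρ̃` of the empirical measure of the `Λ`'s. [cite: Goldbaum2005, §5, eq. (5.5)] -/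
theorem liebWuDensityK_eq_limitDensity (U : ℝ) (m : ℕ) (Λ : Fin (2 * m + 1) → ℝ) (x : ℝ) :
    liebWuDensityK U m Λ x = liebWuLimitDensityK U (empiricalProbabilityMeasure Λ) x := by
  rw [liebWuDensityK, liebWuLimitDensityK, integral_empiricalProbabilityMeasure]
  have hM : (0 : ℝ) < 2 * m + 1 := by positivity
  congr 1
  push_cast
  field_simp
  ring

/-- `2σ_N` is `σ̃` of the empirical measures. [cite: Goldbaum2005, §5, eq. (5.8)] -/
theorem two_mul_liebWuDensityΛ_eq_limitDensity (U : ℝ) (m : ℕ) (k : Fin (4 * m + 2) → ℝ)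
    (Λ : Fin (2 * m + 1) → ℝ) (y : ℝ) :
    2 * liebWuDensityΛ U m k Λ y =
      liebWuLimitDensityΛ U (empiricalProbabilityMeasure k) (empiricalProbabilityMeasure Λ) y := by
  rw [liebWuDensityΛ, liebWuLimitDensityΛ, integral_empiricalProbabilityMeasure,
    integral_empiricalProbabilityMeasure]
  have hM : (0 : ℝ) < 2 * m + 1 := by positivity
  push_cast
  field_simp
  ring

/-- `t ↦ K_c(s - t)` as a bounded continuous test function. [folklore] -/
def cauchyDensityBCF {c : ℝ} (hc : 0 < c) (s : ℝ) : ℝ →ᵇ ℝ :=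
  BoundedContinuousFunction.ofNormedAddCommGroup (fun t => cauchyDensity c (s - t))
    ((continuous_cauchyDensity hc).comp (continuous_const.sub continuous_id)) (1 / (π * c))
    fun t => by
      rw [Real.norm_eq_abs, abs_of_pos (cauchyDensity_pos hc _)]
      exact cauchyDensity_le hc _

/-- Unfolding lemma. [folklore] -/
@[simp] theorem cauchyDensityBCF_apply {c : ℝ} (hc : 0 < c) (s t : ℝ) :
    cauchyDensityBCF hc s t = cauchyDensity c (s - t) := rfl

/-- `s ↦ K_c(y - sin s)` as a bounded continuous test function. [folklore] -/
def cauchyDensitySinBCF {c : ℝ} (hc : 0 < c) (y : ℝ) : ℝ →ᵇ ℝ :=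
  BoundedContinuousFunction.ofNormedAddCommGroup (fun s => cauchyDensity c (y - Real.sin s))
    ((continuous_cauchyDensity hc).comp (continuous_const.sub Real.continuous_sin)) (1 / (π * c))
    fun s => by
      rw [Real.norm_eq_abs, abs_of_pos (cauchyDensity_pos hc _)]
      exact cauchyDensity_le hc _

/-- Unfolding lemma. [folklore] -/
@[simp] theorem cauchyDensitySinBCF_apply {c : ℝ} (hc : 0 < c) (y s : ℝ) :
    cauchyDensitySinBCF hc y s = cauchyDensity c (y - Real.sin s) := rfl

/-- `x ↦ ∫ K_c(sin x - t) dν(t)` is continuous for a finite measure `ν`. [folklore] -/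
theorem continuous_integral_cauchyDensity_sin_sub {c : ℝ} (hc : 0 < c) (ν : Measure ℝ)
    [IsFiniteMeasure ν] : Continuous fun x => ∫ t, cauchyDensity c (Real.sin x - t) ∂ν := by
  refine continuous_of_dominated (bound := fun _ => 1 / (π * c)) (fun x => ?_) (fun x => ?_)
    (integrable_const _) (Eventually.of_forall fun t => ?_)
  · exact ((continuous_cauchyDensity hc).comp (continuous_const.sub continuous_id)).aestronglyMeasurable
  · exact Eventually.of_forall fun t => by
      rw [Real.norm_eq_abs, abs_of_pos (cauchyDensity_pos hc _)]; exact cauchyDensity_le hc _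
  · exact (continuous_cauchyDensity hc).comp (Real.continuous_sin.sub continuous_const)

/-- `y ↦ ∫ K_c(y - sin s) dμ(s)` is continuous for a finite measure `μ`. [folklore] -/
theorem continuous_integral_cauchyDensity_sub_sin {c : ℝ} (hc : 0 < c) (μ : Measure ℝ)
    [IsFiniteMeasure μ] : Continuous fun y => ∫ s, cauchyDensity c (y - Real.sin s) ∂μ := by
  refine continuous_of_dominated (bound := fun _ => 1 / (π * c)) (fun y => ?_) (fun y => ?_)
    (integrable_const _) (Eventually.of_forall fun s => ?_)
  · exact ((continuous_cauchyDensity hc).comp (continuous_const.sub Real.continuous_sin)).aestronglyMeasurable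
  · exact Eventually.of_forall fun s => by
      rw [Real.norm_eq_abs, abs_of_pos (cauchyDensity_pos hc _)]; exact cauchyDensity_le hc _
  · exact (continuous_cauchyDensity hc).comp (continuous_id.sub continuous_const)

/-- `y ↦ ∫ K_c(y - t) dν(t)` is continuous for a finite measure `ν`. [folklore] -/
theorem continuous_integral_cauchyDensity_sub {c : ℝ} (hc : 0 < c) (ν : Measure ℝ)
    [IsFiniteMeasure ν] : Continuous fun y => ∫ t, cauchyDensity c (y - t) ∂ν := by
  refine continuous_of_dominated (bound := fun _ => 1 / (π * c)) (fun y => ?_) (fun y => ?_)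
    (integrable_const _) (Eventually.of_forall fun t => ?_)
  · exact ((continuous_cauchyDensity hc).comp (continuous_const.sub continuous_id)).aestronglyMeasurable
  · exact Eventually.of_forall fun t => by
      rw [Real.norm_eq_abs, abs_of_pos (cauchyDensity_pos hc _)]; exact cauchyDensity_le hc _
  · exact (continuous_cauchyDensity hc).comp (continuous_id.sub continuous_const)

/-- `ρ̃` is continuous. [folklore] -/
theorem continuous_liebWuLimitDensityK {U : ℝ} (hU : 0 < U) (ν : Measure ℝ) [IsFiniteMeasure ν] :
    Continuous (liebWuLimitDensityK U ν) := by
  unfold liebWuLimitDensityK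
  have h := continuous_integral_cauchyDensity_sin_sub (by positivity : 0 < U / 4) ν
  fun_prop

/-- `σ̃` is continuous. [folklore] -/
theorem continuous_liebWuLimitDensityΛ {U : ℝ} (hU : 0 < U) (μ ν : Measure ℝ) [IsFiniteMeasure μ]
    [IsFiniteMeasure ν] : Continuous (liebWuLimitDensityΛ U μ ν) := by
  unfold liebWuLimitDensityΛ
  have h1 := continuous_integral_cauchyDensity_sub_sin (by positivity : 0 < U / 4) μ
  have h2 := continuous_integral_cauchyDensity_sub (by positivity : 0 < U / 2) ν
  fun_prop

/-- Weak convergence gives pointwise convergence of `ρ̃`. [cite: Goldbaum2005, §5, eq. (5.12)] -/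
theorem tendsto_liebWuLimitDensityK {U : ℝ} (hU : 0 < U) {νs : ℕ → ProbabilityMeasure ℝ}
    {ν : ProbabilityMeasure ℝ} (hν : Tendsto νs atTop (𝓝 ν)) (x : ℝ) :
    Tendsto (fun n => liebWuLimitDensityK U (νs n) x) atTop (𝓝 (liebWuLimitDensityK U ν x)) := by
  have hc : 0 < U / 4 := by positivity
  have h := (ProbabilityMeasure.tendsto_iff_forall_integral_tendsto.1 hν) (cauchyDensityBCF hc (Real.sin x))
  simp only [cauchyDensityBCF_apply] at h
  unfold liebWuLimitDensityK
  exact tendsto_const_nhds.add (tendsto_const_nhds.mul (tendsto_const_nhds.mul h))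

/-- Weak convergence gives pointwise convergence of `σ̃`. [cite: Goldbaum2005, §5, eq. (5.13)] -/
theorem tendsto_liebWuLimitDensityΛ {U : ℝ} (hU : 0 < U) {μs νs : ℕ → ProbabilityMeasure ℝ}
    {μ ν : ProbabilityMeasure ℝ} (hμ : Tendsto μs atTop (𝓝 μ)) (hν : Tendsto νs atTop (𝓝 ν)) (y : ℝ) :
    Tendsto (fun n => liebWuLimitDensityΛ U (μs n) (νs n) y) atTop
      (𝓝 (liebWuLimitDensityΛ U μ ν y)) := by
  have hc : 0 < U / 4 := by positivity
  have hc' : 0 < U / 2 := by positivity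
  have h1 := (ProbabilityMeasure.tendsto_iff_forall_integral_tendsto.1 hμ) (cauchyDensitySinBCF hc y)
  have h2 := (ProbabilityMeasure.tendsto_iff_forall_integral_tendsto.1 hν) (cauchyDensityBCF hc' y)
  simp only [cauchyDensitySinBCF_apply, cauchyDensityBCF_apply] at h1 h2
  unfold liebWuLimitDensityΛ
  exact (tendsto_const_nhds.mul h1).sub h2

/-! ### Domination of the subsequential limits (Goldbaum 2005, §5, (5.10)–(5.13), as inequalities) -/

/-- `1/(4 φ(n) + 2) → 0` along a subsequence `φ → ∞`. [folklore] -/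
theorem tendsto_one_div_sites {φ : ℕ → ℕ} (hφ : Tendsto φ atTop atTop) :
    Tendsto (fun n => 1 / (4 * (φ n : ℝ) + 2)) atTop (𝓝 0) := by
  have h1 : Tendsto (fun n => (4 * (φ n : ℝ) + 2)) atTop atTop := by
    refine tendsto_atTop_add_const_right _ _ (Tendsto.const_mul_atTop (by norm_num) ?_)
    exact tendsto_natCast_atTop_atTop.comp hφ
  refine h1.inv_tendsto_atTop.congr fun n => ?_
  rw [Pi.inv_apply, one_div]

/-- `1/(2 φ(n) + 1) → 0` along a subsequence `φ → ∞`. [folklore] -/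
theorem tendsto_one_div_downSpins {φ : ℕ → ℕ} (hφ : Tendsto φ atTop atTop) :
    Tendsto (fun n => 1 / (2 * (φ n : ℝ) + 1)) atTop (𝓝 0) := by
  have h1 : Tendsto (fun n => (2 * (φ n : ℝ) + 1)) atTop atTop := by
    refine tendsto_atTop_add_const_right _ _ (Tendsto.const_mul_atTop (by norm_num) ?_)
    exact tendsto_natCast_atTop_atTop.comp hφ
  refine h1.inv_tendsto_atTop.congr fun n => ?_
  rw [Pi.inv_apply, one_div]

/-- **Domination of the momentum limit (Goldbaum 2005, §5, (5.10)/(5.12) in inequality form).**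
Along a subsequence on which the empirical measures of the `k`'s and of the `Λ`'s converge weakly
to `μ`, `ν`, the limit of the momenta is dominated by the positive part of the limit density:
`μ ≤ (ρ̃_ν)⁺ dk`, `ρ̃_ν(x) = 1/2π + cos x · ½∫K_{U/4}(sin x - t) dν(t)`.
[cite: Goldbaum2005, §5, eqs. (5.10), (5.12)] -/
theorem rootLimit_le_withDensity {U : ℝ} (hU : 0 < U)
    {k : ∀ m : ℕ, Fin (4 * m + 2) → ℝ} {Λ : ∀ m : ℕ, Fin (2 * m + 1) → ℝ}
    (hk : ∀ m, IsLiebWuGroundRoots U m (k m) (Λ m)) {φ : ℕ → ℕ} (hφ : Tendsto φ atTop atTop)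
    {μ ν : ProbabilityMeasure ℝ}
    (hμ : Tendsto (fun n => empiricalProbabilityMeasure (k (φ n))) atTop (𝓝 μ))
    (hν : Tendsto (fun n => empiricalProbabilityMeasure (Λ (φ n))) atTop (𝓝 ν)) :
    (μ : Measure ℝ) ≤ volume.withDensity fun x =>
      ENNReal.ofReal (max (liebWuLimitDensityK U ν x) 0) := by
  have hcont := continuous_liebWuLimitDensityK hU (ν : Measure ℝ)
  refine measure_le_withDensity_of_Ioc_le (hcont.max continuous_const) (fun x => le_max_right _ _)
    fun a b hab => ?_
  refine measure_Ioc_le_of_tendsto hμ (f := fun n x => liebWuDensityK U (φ n) (Λ (φ n)) x)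
    (B := 1 / (2 * π) + 2 / (π * U)) (fun n x => abs_liebWuDensityK_le hU _ _ x)
    (fun n => continuous_liebWuDensityK hU _ _) hcont (fun x => ?_) (tendsto_one_div_sites hφ)
    (fun n a' b' hab' => rootMeasure_Ioc_le hU (hk (φ n)) hab') hab
  simp_rw [liebWuDensityK_eq_limitDensity]
  exact tendsto_liebWuLimitDensityK hU hν x

/-- **Domination of the `Λ` limit (Goldbaum 2005, §5, (5.11)/(5.13) in inequality form).** Along
a jointly convergent subsequence, `ν ≤ (σ̃_{μ,ν})⁺ dΛ` with
`σ̃(y) = 2∫K_{U/4}(y - sin s) dμ(s) - ∫K_{U/2}(y - t) dν(t)`.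
[cite: Goldbaum2005, §5, eqs. (5.11), (5.13)] -/
theorem rapidityLimit_le_withDensity {U : ℝ} (hU : 0 < U)
    {k : ∀ m : ℕ, Fin (4 * m + 2) → ℝ} {Λ : ∀ m : ℕ, Fin (2 * m + 1) → ℝ}
    (hk : ∀ m, IsLiebWuGroundRoots U m (k m) (Λ m)) {φ : ℕ → ℕ} (hφ : Tendsto φ atTop atTop)
    {μ ν : ProbabilityMeasure ℝ}
    (hμ : Tendsto (fun n => empiricalProbabilityMeasure (k (φ n))) atTop (𝓝 μ))
    (hν : Tendsto (fun n => empiricalProbabilityMeasure (Λ (φ n))) atTop (𝓝 ν)) :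
    (ν : Measure ℝ) ≤ volume.withDensity fun y =>
      ENNReal.ofReal (max (liebWuLimitDensityΛ U μ ν y) 0) := by
  have hcont := continuous_liebWuLimitDensityΛ hU (μ : Measure ℝ) (ν : Measure ℝ)
  refine measure_le_withDensity_of_Ioc_le (hcont.max continuous_const) (fun y => le_max_right _ _)
    fun a b hab => ?_
  have hB : ∀ n y, |2 * liebWuDensityΛ U (φ n) (k (φ n)) (Λ (φ n)) y| ≤ 2 * (4 / (π * U) + 1 / (π * U)) := by
    intro n y
    rw [abs_mul, abs_two]
    exact mul_le_mul_of_nonneg_left (abs_liebWuDensityΛ_le hU _ _ _ y) zero_le_two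
  refine measure_Ioc_le_of_tendsto hν (f := fun n y => 2 * liebWuDensityΛ U (φ n) (k (φ n)) (Λ (φ n)) y)
    (B := 2 * (4 / (π * U) + 1 / (π * U))) hB
    (fun n => continuous_const.mul (continuous_liebWuDensityΛ hU _ _ _)) hcont (fun y => ?_)
    (tendsto_one_div_downSpins hφ)
    (fun n a' b' hab' => rapidityMeasure_Ioc_le hU (hk (φ n)) hab') hab
  simp_rw [two_mul_liebWuDensityΛ_eq_limitDensity]
  exact tendsto_liebWuLimitDensityΛ hU hμ hν y

/-- The momentum limit is carried by `[-π, π]` (portmanteau for the closed set `[-π, π]`, which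
has full mass under every empirical measure of the momenta). [cite: Goldbaum2005, Theorem 1.1] -/
theorem rootLimit_compl_Icc_eq_zero {U : ℝ}
    {k : ∀ m : ℕ, Fin (4 * m + 2) → ℝ} {Λ : ∀ m : ℕ, Fin (2 * m + 1) → ℝ}
    (hk : ∀ m, IsLiebWuGroundRoots U m (k m) (Λ m)) {φ : ℕ → ℕ} {μ : ProbabilityMeasure ℝ}
    (hμ : Tendsto (fun n => empiricalProbabilityMeasure (k (φ n))) atTop (𝓝 μ)) :
    (μ : Measure ℝ) (Icc (-π) π)ᶜ = 0 := by
  have hclosed : IsClosed (Icc (-π) π) := isClosed_Icc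
  have h := ProbabilityMeasure.limsup_measure_closed_le_of_tendsto hμ hclosed
  have hone : ∀ n, ((empiricalProbabilityMeasure (k (φ n)) : ProbabilityMeasure ℝ) : Measure ℝ)
      (Icc (-π) π) = 1 := fun n =>
    (prob_compl_eq_zero_iff measurableSet_Icc).1 (rootMeasure_compl_Icc_eq_zero (hk (φ n)))
  simp only [hone, limsup_const] at h
  rw [prob_compl_eq_zero_iff measurableSet_Icc]
  exact le_antisymm prob_le_one h

end Literature.MathematicalPhysics.QuantumLattice
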